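import Summits.Ventures.CertifiedArithmetic.LowPrec.GemmFirstRegimeGrid
import HarnessLib

/-!
# GEMM worst case LXIII-a — LOW WORDS of the first regime, every grid alphabet and precision:
# one inexact low step costs one grid unit of error and buys at least one grid unit of mass

HONEST FRAMING: certified error envelopes and provably optimal rounding/accumulation schemes for
low-precision formats under stated cost models; every table by two implementations; no hardware or
vendor claims.

Setting of file LXII-a (`GemmFirstRegimeGrid`): letters `x j = z_j / 2^G`, `|z_j| ≤ M`, `z_j` odd
only when `|z_j| ≤ m₀`; a format `φ` with `T = 2^(manBits φ + 1)`, `qexp φ ≤ -G`,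
`2^(manBits φ + E + 3) ≤ maxRat φ`; `j₀ = n₀ - 1` is the length of the exact prefix
(`M j₀ + m₀ < T`).  This file is the first half of the EXACT LAW of the first regime for the
alphabets where the Lange–Rump value `k/(T+k)` is NOT attained from `k = 1` (file LXIII-b,
`GemmFirstRegimeLaw`; gemm.tex Prop. p:fpL): the words whose every rounded quantity
`ŝ_{j-1} + x_j` stays below `2T` in grid units (LOW words).

* `roundNE_lowGrid` — ONE LOW ROUNDING: for `|K| < 2T`, `fl(K/2^G)` lies on the grid, has modulus
  `≤ 2T/2^G`, errs by at most ONE grid unit, and is inexact only if `K` is odd with `|K| > T`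
  (the representable grid values below `2T` are exactly `|K| < T` and the even `K`, `grid_repr`).
* `abs_step_err_le_term`, `abs_seqSum_sub_sum_le_tail` — no rounding of `ŝ + x` errs by more than
  `|x|` (`ŝ` itself is a candidate; `roundNE_nearest`), hence `|ŝ_n - s_n| ≤ Σ_{1≤i≤n} |x_i|`.
* `LowInvG`, `lowInvG_base`, `lowInvG_step` — THE BOOKKEEPING INVARIANT along a low word: after the
  exact prefix either no error has occurred, or `N ≥ 1` inexact steps have, `|ŝ - s| ≤ N/2^G`, and
  the mass is `≥ (B + N)/2^G` with `N ≤ #letters - n₀` if the FIRST inexact step was the entry step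
  `n₀` (hypothesis `hB`: an odd `(n₀+1)`-letter sum above `T` has mass `≥ B + 1`; `B + 1 = A*` of
  gemm.tex Prop. p:fpA (v)), else `≥ (T + N)/2^G` with `N ≤ #letters - n₀ - 1` (the first inexact
  sum is itself odd and `> T`).  Each later inexact step adds `≤ 1/2^G` of error and, its letter
  being non-zero, `≥ 1/2^G` of mass.
* `relErr_le_of_lowInvG` — hence `R(x, n₀ + k) ≤ max(k/(B+k), (k-1)/(T+k-1))` for low words.

This is the all-alphabet, all-precision form of gemm.tex Lemma l:low (file `GemmLowTrajectoriesBound`,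
bfloat16 and FP4 products only: `A ≥ 72¼ = A*/4`, `A ≥ 64¼ = (T+1)/4`).
References: [Higham2002, §4.2] (recursive summation), [IEEE7542019, §4.3.1] (nearest-even),
[BoldoEtAl2023, Thm 4.5] and [LangeRump2019] (the value `k/(T+k)`), [RouhaniEtAl2023MX, Table 1].
-/

namespace Summit.Ventures.CertifiedArithmetic.LowPrec.Gemm

open Literature.ComputerArithmetic.FloatingPoint
open Literature.ComputerArithmetic.FloatingPoint.MiniFloat
open Literature.ComputerArithmetic.JeannerodRump2018
open Finset

variable {φ : Format}

/-! ### A rounding never errs by more than the added term -/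

/-- `|fl(ŝ_n + x_{n+1}) - (ŝ_n + x_{n+1})| ≤ |x_{n+1}|`: the previous accumulator is a value of
`φ` and rounding is to a nearest value. [folklore; cite: IEEE7542019, §4.3.1] -/
theorem abs_step_err_le_term (w : ℕ → ℚ) (n : ℕ) :
    |(seqSum φ w (n + 1)).toRat - ((seqSum φ w n).toRat + w (n + 1))| ≤ |w (n + 1)| := by
  have h := roundNE_nearest (φ := φ) ((seqSum φ w n).toRat + w (n + 1)) (seqSum φ w n)
  rw [show (seqSum φ w n).toRat + w (n + 1) - (seqSum φ w n).toRat = w (n + 1) by ring] at h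
  have e : seqSum φ w (n + 1) = roundNE φ ((seqSum φ w n).toRat + w (n + 1)) := rfl
  rw [e, abs_sub_comm]
  exact h

/-- Hence, when the first term is a value of `φ`, `|ŝ_n - s_n| ≤ Σ_{1 ≤ i ≤ n} |w_i|`. [folklore] -/
theorem abs_seqSum_sub_sum_le_tail (w : ℕ → ℚ) (h0 : ∃ y : MiniFloat φ, y.toRat = w 0) :
    ∀ n, |(seqSum φ w n).toRat - ∑ i ∈ range (n + 1), w i| ≤ ∑ i ∈ range n, |w (i + 1)|
  | 0 => by
      simp only [seqSum, zero_add, range_one, sum_singleton, range_zero, sum_empty]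
      rw [toRat_roundNE_of_exists h0, sub_self, abs_zero]
  | n + 1 => by
      have ih := abs_seqSum_sub_sum_le_tail w h0 n
      have hs := abs_step_err_le_term (φ := φ) w n
      rw [sum_range_succ w (n + 1), sum_range_succ (fun i => |w (i + 1)|) n]
      have h3 := abs_sub_le (seqSum φ w (n + 1)).toRat ((seqSum φ w n).toRat + w (n + 1))
        (∑ i ∈ range (n + 1), w i + w (n + 1))
      rw [show (seqSum φ w n).toRat + w (n + 1) - (∑ i ∈ range (n + 1), w i + w (n + 1))
          = (seqSum φ w n).toRat - ∑ i ∈ range (n + 1), w i by ring] at h3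
      linarith

/-- `N/(B+N)` is increasing in `N`. [folklore] -/
theorem frac_mono {Bq : ℚ} (hB : 0 ≤ Bq) {N k : ℕ} (hN : 1 ≤ N) (h : N ≤ k) :
    (N : ℚ) / (Bq + N) ≤ (k : ℚ) / (Bq + k) := by
  have hNq : (1 : ℚ) ≤ N := by exact_mod_cast hN
  have hk : (N : ℚ) ≤ k := by exact_mod_cast h
  rw [div_le_div_iff₀ (by linarith) (by linarith)]
  nlinarith

section Grid

variable {G M m0 E : ℕ}

/-! ### One low rounding on the grid `2^-G` -/

section Round

variable (hq : φ.qexp ≤ -(G : ℤ)) (hR : (2 : ℚ) ^ (φ.manBits + E + 3) ≤ φ.maxRat)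
include hq hR

/-- ONE LOW ROUNDING, every precision: for `|K| < 2T` (`T = 2^(manBits+1)`), `fl_φ(K/2^G)`
(i) errs by at most one grid unit, (ii) lies on the grid, (iii) has modulus `≤ 2T/2^G`, and
(iv) is inexact only if `K` is odd with `|K| > T`. [cell, gemm.tex Prop. p:fpL; cite: IEEE7542019, §4.3.1] -/
theorem roundNE_lowGrid {K : ℤ} (hK : K.natAbs < 2 ^ (φ.manBits + 2)) :
    |(roundNE φ ((K : ℚ) / 2 ^ G)).toRat - (K : ℚ) / 2 ^ G| ≤ 1 / 2 ^ G ∧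
    (∃ K' : ℤ, (roundNE φ ((K : ℚ) / 2 ^ G)).toRat = (K' : ℚ) / 2 ^ G) ∧
    |(roundNE φ ((K : ℚ) / 2 ^ G)).toRat| ≤ 2 ^ (φ.manBits + 2) / 2 ^ G ∧
    ((roundNE φ ((K : ℚ) / 2 ^ G)).toRat ≠ (K : ℚ) / 2 ^ G →
      2 ^ (φ.manBits + 1) < K.natAbs ∧ K % 2 ≠ 0) := by
  have hGpos : (0 : ℚ) < 2 ^ G := by positivity
  have hT2 : 2 ^ (φ.manBits + 2) = 2 * 2 ^ (φ.manBits + 1) := by ring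
  have hT1 : 2 ^ (φ.manBits + 1) = 2 * 2 ^ φ.manBits := by ring
  -- exactness below `T` and at even patterns below `2T`
  have hexact : K.natAbs < 2 ^ (φ.manBits + 1) ∨ K % 2 = 0 →
      (roundNE φ ((K : ℚ) / 2 ^ G)).toRat = (K : ℚ) / 2 ^ G := by
    intro h
    apply toRat_roundNE_of_exists
    apply grid_repr hq hR
    rcases h with h | h
    · exact Or.inl h
    · exact Or.inr ⟨h, hK⟩
  -- (iv)
  have hinex : (roundNE φ ((K : ℚ) / 2 ^ G)).toRat ≠ (K : ℚ) / 2 ^ G →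
      2 ^ (φ.manBits + 1) < K.natAbs ∧ K % 2 ≠ 0 := by
    intro hne
    have hA : ¬ K.natAbs < 2 ^ (φ.manBits + 1) := fun h => hne (hexact (Or.inl h))
    have hB : K % 2 ≠ 0 := fun h => hne (hexact (Or.inr h))
    refine ⟨?_, hB⟩
    rcases lt_or_eq_of_le (not_lt.mp hA) with h | h
    · exact h
    · exfalso; apply hB; omega
  -- (i)
  have herr : |(roundNE φ ((K : ℚ) / 2 ^ G)).toRat - (K : ℚ) / 2 ^ G| ≤ 1 / 2 ^ G := by
    by_cases hex : (roundNE φ ((K : ℚ) / 2 ^ G)).toRat = (K : ℚ) / 2 ^ G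
    · rw [hex, sub_self, abs_zero]; positivity
    · obtain ⟨hbig, hodd⟩ := hinex hex
      -- the even neighbour toward zero is a value of `φ` at distance one grid unit
      obtain ⟨K₀, hK₀ev, hK₀lt, hK₀d⟩ : ∃ K₀ : ℤ, K₀ % 2 = 0 ∧ K₀.natAbs < 2 ^ (φ.manBits + 2) ∧
          (K - K₀ = 1 ∨ K - K₀ = -1) := by
        rcases lt_or_ge K 0 with hneg | hpos
        · exact ⟨K + 1, by omega, by omega, Or.inr (by omega)⟩
        · exact ⟨K - 1, by omega, by omega, Or.inl (by omega)⟩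
      have hdist : |(K : ℚ) / 2 ^ G - (K₀ : ℚ) / 2 ^ G| = 1 / 2 ^ G := by
        rw [← sub_div, abs_div, abs_of_pos hGpos, ← Int.cast_sub]
        rcases hK₀d with h | h <;> rw [h] <;> norm_num
      obtain ⟨y, hy⟩ := grid_repr hq hR (K := K₀) (Or.inr ⟨hK₀ev, hK₀lt⟩)
      have hn := roundNE_nearest (φ := φ) ((K : ℚ) / 2 ^ G) y
      rw [hy, hdist] at hn
      rwa [abs_sub_comm]
  -- (iii)
  have hval : |(roundNE φ ((K : ℚ) / 2 ^ G)).toRat| ≤ 2 ^ (φ.manBits + 2) / 2 ^ G := by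
    have hXle : |(K : ℚ) / 2 ^ G| ≤ (2 ^ (φ.manBits + 2) - 1) / 2 ^ G := by
      rw [abs_div, abs_of_pos hGpos, ← Int.cast_abs, Int.abs_eq_natAbs, Int.cast_natCast]
      apply div_le_div_of_nonneg_right _ hGpos.le
      have hK1 : K.natAbs + 1 ≤ 2 ^ (φ.manBits + 2) := hK
      have : ((K.natAbs + 1 : ℕ) : ℚ) ≤ ((2 ^ (φ.manBits + 2) : ℕ) : ℚ) := by exact_mod_cast hK1
      push_cast at this
      linarith
    have h3 := abs_sub_abs_le_abs_sub (roundNE φ ((K : ℚ) / 2 ^ G)).toRat ((K : ℚ) / 2 ^ G)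
    have e : (2 : ℚ) ^ (φ.manBits + 2) / 2 ^ G = (2 ^ (φ.manBits + 2) - 1) / 2 ^ G + 1 / 2 ^ G := by
      ring
    linarith
  refine ⟨herr, ?_, hval, hinex⟩
  -- (ii) via the bridge `fl(K/2^G) = rneZ K / 2^G`
  have hR' : (2 : ℚ) ^ (φ.manBits + (E + 3)) ≤ φ.maxRat := by rwa [← add_assoc]
  have hKlt : K.natAbs < 2 ^ (φ.manBits + (E + 3) + G) :=
    lt_of_lt_of_le hK (Nat.pow_le_pow_right (by norm_num) (by omega))
  exact ⟨rneZ φ.manBits K, toRat_roundNE_grid_prec hq K (grid_le_maxRat_of_lt hR' hKlt)⟩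

end Round

/-! ### Words: letters in grid units, the low invariant -/

/-- The letter `x i` in grid units: `(2^G · x i).num`. [cell] -/
def zl (G : ℕ) (x : ℕ → ℚ) (i : ℕ) : ℤ := ((2 : ℚ) ^ G * x i).num

/-- THE LOW BOOKKEEPING INVARIANT after `n + 1` letters (`n₀ = j₀ + 1`, bonus `B`): the accumulator
is a grid value of modulus `≤ 2T/2^G`, and EITHER no rounding error has occurred, OR `N ≥ 1`
inexact steps have, with `|ŝ - s| ≤ N/2^G` and mass `≥ (B+N)/2^G`, `N ≤ n + 1 - n₀` (first inexact
step at the entry `n₀`) or mass `≥ (T+N)/2^G`, `N ≤ n - n₀` (first inexact step later).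
[cell, gemm.tex Prop. p:fpL] -/
def LowInvG (φ : Format) (G Bn n0 : ℕ) (x : ℕ → ℚ) (n : ℕ) : Prop :=
  (∃ V : ℤ, (seqSum φ x n).toRat = (V : ℚ) / 2 ^ G) ∧
  |(seqSum φ x n).toRat| ≤ 2 ^ (φ.manBits + 2) / 2 ^ G ∧
  ((seqSum φ x n).toRat = ∑ i ∈ range (n + 1), x i ∨
    ∃ N : ℕ, 1 ≤ N ∧
      |(seqSum φ x n).toRat - ∑ i ∈ range (n + 1), x i| ≤ (N : ℚ) / 2 ^ G ∧
      ((((Bn : ℚ) + N) / 2 ^ G ≤ ∑ i ∈ range (n + 1), |x i| ∧ N + n0 ≤ n + 1) ∨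
        ((2 ^ (φ.manBits + 1) + (N : ℚ)) / 2 ^ G ≤ ∑ i ∈ range (n + 1), |x i| ∧
          N + n0 + 1 ≤ n + 1)))

variable {x : ℕ → ℚ}
  (hx : ∀ j, ∃ z : ℤ, x j = (z : ℚ) / 2 ^ G ∧ z.natAbs ≤ M ∧ (z % 2 = 0 ∨ z.natAbs ≤ m0))
include hx

/-- The letter in grid units: `x i = zl i / 2^G`, `|zl i| ≤ M`, odd only when `≤ m₀`. [cell] -/
theorem zl_spec (i : ℕ) : x i = ((zl G x i : ℤ) : ℚ) / 2 ^ G ∧ (zl G x i).natAbs ≤ M ∧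
    ((zl G x i) % 2 = 0 ∨ (zl G x i).natAbs ≤ m0) :=
  letter_numG hx i

/-- Mass in grid units: `Σ_{i<n} |x i| = (Σ_{i<n} |zl i|)/2^G`. [cell] -/
theorem sum_abs_eq_natG (n : ℕ) :
    ∑ i ∈ range n, |x i| = ((∑ i ∈ range n, (zl G x i).natAbs : ℕ) : ℚ) / 2 ^ G := by
  have hGpos : (0 : ℚ) < 2 ^ G := by positivity
  rw [Nat.cast_sum, div_eq_mul_inv, Finset.sum_mul]
  refine sum_congr rfl (fun i _ => ?_)
  rw [(zl_spec hx i).1, abs_div, abs_of_pos hGpos, Nat.cast_natAbs, Int.cast_abs, div_eq_mul_inv]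

/-- `Σ_{i≤j} x i = (Σ_{i≤j} zl i)/2^G`. [cell] -/
theorem sum_eq_zlG (j : ℕ) : ∑ i ∈ range (j + 1), x i
    = ((∑ i ∈ range (j + 1), zl G x i : ℤ) : ℚ) / 2 ^ G :=
  sum_eq_KZG hx j

section Regime

variable (hq : φ.qexp ≤ -(G : ℤ)) (hR : (2 : ℚ) ^ (φ.manBits + E + 3) ≤ φ.maxRat)
  (hm0M : m0 ≤ M) (hMT : M ≤ 2 ^ (φ.manBits + 1))
include hq hR hm0M hMT

/-- BASE: after the exact prefix (`n = j₀`, `M j₀ + m₀ < T`) the invariant holds with no error.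
[cell, gemm.tex Prop. p:fpA (i)] -/
theorem lowInvG_base {j0 : ℕ} (hj0 : M * j0 + m0 < 2 ^ (φ.manBits + 1)) (Bn : ℕ) :
    LowInvG φ G Bn (j0 + 1) x j0 := by
  have hGpos : (0 : ℚ) < 2 ^ G := by positivity
  have hT2 : 2 ^ (φ.manBits + 2) = 2 * 2 ^ (φ.manBits + 1) := by ring
  have hex := seqSum_exact_prefixG hx hq hR hm0M hMT hj0 j0 le_rfl
  refine ⟨⟨∑ i ∈ range (j0 + 1), zl G x i, by rw [hex, sum_eq_zlG hx]⟩, ?_, Or.inl hex⟩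
  rw [hex, sum_eq_zlG hx, abs_div, abs_of_pos hGpos, ← Int.cast_abs, Int.abs_eq_natAbs,
    Int.cast_natCast]
  apply div_le_div_of_nonneg_right _ hGpos.le
  have hle : (∑ i ∈ range (j0 + 1), zl G x i).natAbs ≤ 2 ^ (φ.manBits + 2) := by
    have h1 : M * (j0 + 1) = M * j0 + M := by ring
    rcases KZ_shapeG hx hm0M j0 with ⟨_, h⟩ | h
    · change (∑ i ∈ range (j0 + 1), zl G x i).natAbs ≤ M * (j0 + 1) at h; omega
    · change (∑ i ∈ range (j0 + 1), zl G x i).natAbs ≤ M * j0 + m0 at h; omega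
  exact_mod_cast hle

omit hm0M hMT in
/-- STEP of the invariant along a low word (`n ≥ j₀`, `|ŝ_n + x_{n+1}| < 2T/2^G`); `hB` is the
entry-mass hypothesis: an odd `(n₀+1)`-letter sum of modulus `> T` has mass `≥ (B+1)/2^G`.
[cell, gemm.tex Prop. p:fpL] -/
theorem lowInvG_step {j0 Bn : ℕ}
    (hB : (∑ i ∈ range (j0 + 2), zl G x i) % 2 ≠ 0 →
      2 ^ (φ.manBits + 1) < (∑ i ∈ range (j0 + 2), zl G x i).natAbs →
      ((Bn : ℚ) + 1) / 2 ^ G ≤ ∑ i ∈ range (j0 + 2), |x i|)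
    {n : ℕ} (hn : j0 ≤ n)
    (hlow : |(seqSum φ x n).toRat + x (n + 1)| < 2 ^ (φ.manBits + 2) / 2 ^ G)
    (hinv : LowInvG φ G Bn (j0 + 1) x n) : LowInvG φ G Bn (j0 + 1) x (n + 1) := by
  have hGpos : (0 : ℚ) < 2 ^ G := by positivity
  obtain ⟨⟨V, hV⟩, -, hacc⟩ := hinv
  obtain ⟨hxz, hzM, -⟩ := zl_spec hx (n + 1)
  set v := (seqSum φ x n).toRat with hv
  set X := v + x (n + 1) with hXdef
  set K : ℤ := V + zl G x (n + 1) with hKdef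
  have hXq : X = (K : ℚ) / 2 ^ G := by rw [hXdef, hV, hxz, hKdef]; push_cast; ring
  have hK : K.natAbs < 2 ^ (φ.manBits + 2) := by
    have h1 : |X| < 2 ^ (φ.manBits + 2) / 2 ^ G := hlow
    rw [hXq, abs_div, abs_of_pos hGpos, div_lt_div_iff_of_pos_right hGpos, ← Int.cast_abs,
      Int.abs_eq_natAbs, Int.cast_natCast] at h1
    exact_mod_cast h1
  obtain ⟨herr, hgrid, hval', hinex⟩ := roundNE_lowGrid hq hR hK
  rw [← hXq] at herr hgrid hval' hinex
  have hstep : (seqSum φ x (n + 1)).toRat = (roundNE φ X).toRat := rfl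
  refine ⟨by rw [hstep]; exact hgrid, by rw [hstep]; exact hval', ?_⟩
  rw [hstep, sum_range_succ x (n + 1), sum_range_succ (fun j => |x j|) (n + 1)]
  set S := ∑ j ∈ range (n + 1), x j with hS
  set L := ∑ j ∈ range (n + 1), |x j| with hL_def
  have hSL : |S| ≤ L := abs_sum_le_sum_abs _ _
  have hxnn : 0 ≤ |x (n + 1)| := abs_nonneg _
  by_cases hex : (roundNE φ X).toRat = X
  · -- exact step: bookkeeping unchanged, mass grows
    rw [hex]
    rcases hacc with h | ⟨N, hN, hE, hcase⟩
    · left; rw [hXdef, h]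
    · right
      have e1 : X - (S + x (n + 1)) = v - S := by rw [hXdef]; ring
      refine ⟨N, hN, by rw [e1]; exact hE, ?_⟩
      rcases hcase with ⟨hA, hNk⟩ | ⟨hA, hNk⟩
      · exact Or.inl ⟨by linarith, by omega⟩
      · exact Or.inr ⟨by linarith, by omega⟩
  · -- inexact step: `K` odd, `|K| > T`, error `≤ 1/2^G` more, letter non-zero
    obtain ⟨hbig, hodd⟩ := hinex hex
    have hx_ne : x (n + 1) ≠ 0 := by
      intro h0; apply hex; rw [hXdef, h0, add_zero, hv, toRat_roundNE_toRat]
    have hxq : 1 / 2 ^ G ≤ |x (n + 1)| := by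
      rw [hxz, abs_div, abs_of_pos hGpos, ← Int.cast_abs]
      apply div_le_div_of_nonneg_right _ hGpos.le
      have hz0 : zl G x (n + 1) ≠ 0 := by intro h; apply hx_ne; rw [hxz, h]; simp
      exact_mod_cast Int.one_le_abs hz0
    right
    rcases hacc with h | ⟨N, hN, hE, hcase⟩
    · -- FIRST inexact step
      have hXS : X = S + x (n + 1) := by rw [hXdef, h]
      have hE1 : |(roundNE φ X).toRat - (S + x (n + 1))| ≤ ((1 : ℕ) : ℚ) / 2 ^ G := by
        rw [← hXS]; push_cast; exact herr
      refine ⟨1, le_rfl, hE1, ?_⟩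
      rcases Nat.lt_or_ge (n + 1) (j0 + 2) with hfirst | hlater
      · -- the entry step `n + 1 = n₀`: the bonus `B`
        have hn1 : n = j0 := by omega
        left
        have hVsum : V = ∑ i ∈ range (n + 1), zl G x i := by
          have h1 : (V : ℚ) / 2 ^ G = ((∑ i ∈ range (n + 1), zl G x i : ℤ) : ℚ) / 2 ^ G := by
            rw [← hV, h, hS, sum_eq_zlG hx]
          exact_mod_cast (div_left_inj' (ne_of_gt hGpos)).mp h1
        have hKsum : K = ∑ i ∈ range (j0 + 2), zl G x i := by
          rw [hKdef, hVsum, hn1, sum_range_succ _ (j0 + 1)]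
        have hmass := hB (by rw [← hKsum]; exact hodd) (by rw [← hKsum]; exact hbig)
        rw [sum_range_succ (fun j => |x j|) (j0 + 1), ← hn1] at hmass
        refine ⟨?_, by omega⟩
        push_cast; exact hmass
      · right
        have hXge : (2 ^ (φ.manBits + 1) + ((1 : ℕ) : ℚ)) / 2 ^ G ≤ |X| := by
          rw [hXq, abs_div, abs_of_pos hGpos, ← Int.cast_abs, Int.abs_eq_natAbs, Int.cast_natCast]
          apply div_le_div_of_nonneg_right _ hGpos.le
          have h1 : 2 ^ (φ.manBits + 1) + 1 ≤ K.natAbs := hbig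
          have h2 : ((2 ^ (φ.manBits + 1) + 1 : ℕ) : ℚ) ≤ ((K.natAbs : ℕ) : ℚ) := by
            exact_mod_cast h1
          push_cast at h2 ⊢
          exact h2
        have hmass : |X| ≤ L + |x (n + 1)| := by
          rw [hXS]; exact le_trans (abs_add_le _ _) (by linarith)
        exact ⟨by linarith, by omega⟩
    · -- a later inexact step
      have e1 : (roundNE φ X).toRat - (S + x (n + 1)) = ((roundNE φ X).toRat - X) + (v - S) := by
        rw [hXdef]; ring
      have hE' : |(roundNE φ X).toRat - (S + x (n + 1))| ≤ ((N + 1 : ℕ) : ℚ) / 2 ^ G := by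
        rw [e1]
        have := abs_add_le ((roundNE φ X).toRat - X) (v - S)
        push_cast; rw [add_div]; linarith
      refine ⟨N + 1, by omega, hE', ?_⟩
      rcases hcase with ⟨hA, hNk⟩ | ⟨hA, hNk⟩
      · left; refine ⟨?_, by omega⟩
        push_cast
        rw [show ((Bn : ℚ) + (N + 1)) / 2 ^ G = ((Bn : ℚ) + N) / 2 ^ G + 1 / 2 ^ G by ring]
        linarith
      · right; refine ⟨?_, by omega⟩
        push_cast
        rw [show ((2 : ℚ) ^ (φ.manBits + 1) + (N + 1)) / 2 ^ G
            = (2 ^ (φ.manBits + 1) + N) / 2 ^ G + 1 / 2 ^ G by ring]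
        linarith

/-- THE INVARIANT ALONG A LOW WORD: low steps from `j₀` to `n` give `LowInvG` at `n`. [cell] -/
theorem lowInvG_of_low {j0 Bn : ℕ} (hj0 : M * j0 + m0 < 2 ^ (φ.manBits + 1))
    (hB : (∑ i ∈ range (j0 + 2), zl G x i) % 2 ≠ 0 →
      2 ^ (φ.manBits + 1) < (∑ i ∈ range (j0 + 2), zl G x i).natAbs →
      ((Bn : ℚ) + 1) / 2 ^ G ≤ ∑ i ∈ range (j0 + 2), |x i|) :
    ∀ d : ℕ, (∀ j, j0 ≤ j → j < j0 + d →
      |(seqSum φ x j).toRat + x (j + 1)| < 2 ^ (φ.manBits + 2) / 2 ^ G) →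
      LowInvG φ G Bn (j0 + 1) x (j0 + d)
  | 0, _ => by rw [Nat.add_zero]; exact lowInvG_base hx hq hR hm0M hMT hj0 Bn
  | d + 1, hlow => by
      rw [← Nat.add_assoc]
      exact lowInvG_step hx hq hR hB (by omega) (hlow (j0 + d) (by omega) (by omega))
        (lowInvG_of_low hj0 hB d (fun j h1 h2 => hlow j h1 (by omega)))

end Regime

omit hx in
/-- THE LOW BOUND: the invariant after `n₀ + k` letters (`k = d + 1`) gives
`R(x, j₀+1+d) ≤ max((d+1)/(B+d+1), d/(T+d))`. [cell, gemm.tex Prop. p:fpL] -/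
theorem relErr_le_of_lowInvG {j0 Bn d : ℕ} (hinv : LowInvG φ G Bn (j0 + 1) x (j0 + 1 + d)) :
    relErr φ x (j0 + 1 + d) ≤ max (((d + 1 : ℕ) : ℚ) / ((Bn : ℚ) + ((d + 1 : ℕ) : ℚ)))
      ((d : ℚ) / (2 ^ (φ.manBits + 1) + d)) := by
  have hGpos : (0 : ℚ) < 2 ^ G := by positivity
  have hmax0 : 0 ≤ max (((d + 1 : ℕ) : ℚ) / ((Bn : ℚ) + ((d + 1 : ℕ) : ℚ)))
      ((d : ℚ) / (2 ^ (φ.manBits + 1) + d)) :=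
    le_trans (by positivity) (le_max_right _ _)
  obtain ⟨-, -, hacc⟩ := hinv
  unfold relErr
  set Er := |(seqSum φ x (j0 + 1 + d)).toRat - ∑ j ∈ range (j0 + 1 + d + 1), x j| with hEr
  set L := ∑ j ∈ range (j0 + 1 + d + 1), |x j| with hL
  rcases hacc with h | ⟨N, hN, hE, hcase⟩
  · rw [hEr, h, sub_self, abs_zero, zero_div]; exact hmax0
  · have hNq : (1 : ℚ) ≤ N := by exact_mod_cast hN
    have key : ∀ {Bq : ℚ} {k : ℕ}, 0 ≤ Bq → (Bq + N) / 2 ^ G ≤ L → N ≤ k →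
        Er / L ≤ (k : ℚ) / (Bq + k) := by
      intro Bq k hBq hLB hNk
      have hLpos : 0 < L := lt_of_lt_of_le (by positivity) hLB
      refine le_trans ?_ (frac_mono hBq hN hNk)
      rw [div_le_iff₀ hLpos]
      calc Er ≤ (N : ℚ) / 2 ^ G := hE
        _ = (N : ℚ) / (Bq + N) * ((Bq + N) / 2 ^ G) := by field_simp
        _ ≤ (N : ℚ) / (Bq + N) * L := mul_le_mul_of_nonneg_left hLB (by positivity)
    rcases hcase with ⟨hA, hNk⟩ | ⟨hA, hNk⟩
    · exact le_trans (key (Nat.cast_nonneg Bn) hA (by omega)) (le_max_left _ _)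
    · exact le_trans (key (by positivity) hA (by omega)) (le_max_right _ _)

end Grid

end Summit.Ventures.CertifiedArithmetic.LowPrec.Gemm
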